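import Mathlib
import HarnessLib

/-!
# S2β · `hFlat` road, brick (G5) of UV3-NODE §57.8 (A)∕(C)(2) — THE COUPLING IDENTITY: «coupled mean − independent mean = the mean
# of the MIXED SECOND DIFFERENCES» (exact finite combinatorics), its norm corollary «≤ 2·C·s·(mean fluctuation)», and the
# three-step telescoping for a four-slot word

Cell `ym3-torus` (rung R3 = continuum `SU(2)` Yang–Mills on the three-torus — NOT d = 4, NOT infinite volume, NOT a mass gap, NOT Clay).
Width seat «width 8» `ym3-torus-px8` (gen 21), FREE px helper on crux `stmt-QuantumFields-20520`, count-neutral, DEFINITION-FREE, Mathlib-only.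

WHY (UV3-NODE §57.8 (A) and (C)(2)).  A SUM of expectations depends only on the marginals, so independent member indices of consecutive
edges may be COUPLED along bijections `σ` (member paths CONTINUE, comb hairpins collapse).  For a NONLINEAR functional `Φ(i, j)` of two member
indices the coupling is no longer free, but the error is EXACTLY the triple mean of mixed second differences (§1), which the coupling letter
✓`…S2BetaMlogMixedDifference.norm_mixedDiff_mlog_le` bounds by (fluctuation) × (size); §2 gives the resulting «chargeable × small» bound; §3 telescopes a
four-slot word (the four coarse bonds of a plaquette) into three two-slot couplings.

* §1 ★★ `card_sq_smul_sum_coupled_sub_eq`, `mean_coupled_sub_mean_indep_eq` :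
  `n⁻¹·Σ_i Φ i (σ i) − n⁻²·Σ_{i,j} Φ i j = n⁻³·Σ_{i,j,i′} (Φ i (σ i) − Φ i j − Φ i′ (σ i) + Φ i′ j)`.
* §2 ★★ `norm_mean_coupled_sub_mean_indep_le` : if every mixed second difference is `≤ C·(α i + α i′)·s` then the coupling error is `≤ 2·C·s·(n⁻¹ Σ_i α i)`.
* §3 ★ `mean_chain4_sub_mean_indep_eq` (+ `norm_mean_chain4_sub_mean_indep_le`): the fully coupled four-slot mean minus the independent one is the SUM of
  three two-slot coupling errors (with the explicit intermediate functionals `Φ₁, Φ₂, Φ₃`).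

HONEST SCOPE.  Finite sums and reindexing by permutations (`Equiv.sum_comp`); nothing of Bałaban's analysis; the nonabelian KEY LEMMA, the recursion, `hFlat`,
TUBE-REG∘, GAP♯∘, S2β, crux 20520 and `YM3TorusSU2` are NOT proved; no registered stub is closed; the Yang–Mills mass gap is NOT proved.
References: T. Bałaban, CMP **109** (1987) [Balaban1987RG1] ((0.4)–(0.8) p.253: the averaged bond as a mean over member transports);
T. Bałaban, CMP **99** (1985) [Balaban1985RegularSpaces].
-/

set_option autoImplicit false

noncomputable section

open Finset
open scoped BigOperators

namespace Summit.QuantumFields.YangMills.Theorems.FluctuationComparisonRegPrIntLS2BetaCouplingIdentity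

variable {ι : Type*} [Fintype ι] {V : Type*} [NormedAddCommGroup V] [NormedSpace ℝ V]

/-! ## §1 The coupling identity -/

/-- ★★ **THE COUPLING IDENTITY (cleared denominators)**: for any `Φ : ι → ι → V` and any bijection `σ` of the finite index set (`n = |ι|`),
`n²·Σ_i Φ i (σ i) − n·Σ_i Σ_j Φ i j = Σ_i Σ_j Σ_{i′} (Φ i (σ i) − Φ i j − Φ i′ (σ i) + Φ i′ j)` — the two «cross» triple sums
`Σ Φ i′ (σ i)` and `Σ Φ i′ j` coincide after reindexing `k = σ i`. [folklore] -/
theorem card_sq_smul_sum_coupled_sub_eq (Φ : ι → ι → V) (σ : Equiv.Perm ι) :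
    ((Fintype.card ι : ℝ) ^ 2) • ∑ i, Φ i (σ i) - (Fintype.card ι : ℝ) • ∑ i, ∑ j, Φ i j =
      ∑ i, ∑ j, ∑ i', (Φ i (σ i) - Φ i j - Φ i' (σ i) + Φ i' j) := by
  have hcross : ∑ i, ∑ _j : ι, ∑ i', Φ i' (σ i) = ∑ _i : ι, ∑ j, ∑ i', Φ i' j := by
    calc ∑ i, ∑ _j : ι, ∑ i', Φ i' (σ i) = ∑ _j : ι, ∑ i, ∑ i', Φ i' (σ i) := Finset.sum_comm
      _ = ∑ _j : ι, ∑ k, ∑ i', Φ i' k := by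
          refine Finset.sum_congr rfl fun j _ => ?_
          exact Equiv.sum_comp σ (fun k => ∑ i', Φ i' k)
      _ = ∑ _i : ι, ∑ j, ∑ i', Φ i' j := rfl
  have e : ∑ i, ∑ j, ∑ i', (Φ i (σ i) - Φ i j - Φ i' (σ i) + Φ i' j) =
      (∑ i, ∑ _j : ι, ∑ _i' : ι, Φ i (σ i)) - (∑ i, ∑ j, ∑ _i' : ι, Φ i j) - (∑ i, ∑ _j : ι, ∑ i', Φ i' (σ i)) +
        ∑ _i : ι, ∑ j, ∑ i', Φ i' j := by
    simp only [Finset.sum_add_distrib, Finset.sum_sub_distrib]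
  rw [e, hcross, sub_add_cancel]
  simp only [Finset.sum_const, Finset.card_univ, ← Nat.cast_smul_eq_nsmul ℝ, smul_smul, Finset.smul_sum, sq]

/-- ★★ **THE COUPLING IDENTITY (means)**: `n⁻¹·Σ_i Φ i (σ i) − (n²)⁻¹·Σ_i Σ_j Φ i j = (n³)⁻¹·Σ_i Σ_j Σ_{i′} (Φ i (σ i) − Φ i j − Φ i′ (σ i) + Φ i′ j)`:
the mean over the COUPLED pair `(i, σ i)` minus the mean over INDEPENDENT `(i, j)` is the triple mean of the mixed second differences. [folklore] -/
theorem mean_coupled_sub_mean_indep_eq [Nonempty ι] (Φ : ι → ι → V) (σ : Equiv.Perm ι) :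
    ((Fintype.card ι : ℝ))⁻¹ • ∑ i, Φ i (σ i) - ((Fintype.card ι : ℝ) ^ 2)⁻¹ • ∑ i, ∑ j, Φ i j =
      ((Fintype.card ι : ℝ) ^ 3)⁻¹ • ∑ i, ∑ j, ∑ i', (Φ i (σ i) - Φ i j - Φ i' (σ i) + Φ i' j) := by
  have hn : (Fintype.card ι : ℝ) ≠ 0 := Nat.cast_ne_zero.mpr Fintype.card_ne_zero
  rw [← card_sq_smul_sum_coupled_sub_eq, smul_sub, ← mul_smul, ← mul_smul]
  congr 2
  · field_simp
  · field_simp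

/-! ## §2 The norm corollary: coupling costs (fluctuation) × (size) -/

omit [NormedSpace ℝ V] in
/-- Triangle inequality for a triple sum. [folklore] -/
theorem norm_sum_sum_sum_le (D : ι → ι → ι → V) : ‖∑ i, ∑ j, ∑ i', D i j i'‖ ≤ ∑ i, ∑ j, ∑ i', ‖D i j i'‖ := by
  refine (norm_sum_le _ _).trans (Finset.sum_le_sum fun i _ => ?_)
  refine (norm_sum_le _ _).trans (Finset.sum_le_sum fun j _ => ?_)
  exact norm_sum_le _ _

/-- The bookkeeping sum: `Σ_i Σ_j Σ_{i′} C·(α i + α i′)·s = 2·C·s·n²·Σ_i α i`. [folklore] -/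
theorem sum_sum_sum_fluct_eq (α : ι → ℝ) (C s : ℝ) :
    ∑ i : ι, ∑ _j : ι, ∑ i' : ι, C * (α i + α i') * s = 2 * C * s * (Fintype.card ι : ℝ) ^ 2 * ∑ i, α i := by
  have e : ∀ i, ∑ i' : ι, C * (α i + α i') * s = (Fintype.card ι : ℝ) * (C * s * α i) + C * s * ∑ i', α i' := by
    intro i
    calc ∑ i' : ι, C * (α i + α i') * s = ∑ i' : ι, (C * s * α i + C * s * α i') :=
          Finset.sum_congr rfl fun i' _ => by ring
      _ = (∑ _i' : ι, C * s * α i) + ∑ i', C * s * α i' := Finset.sum_add_distrib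
      _ = (Fintype.card ι : ℝ) * (C * s * α i) + C * s * ∑ i', α i' := by
          rw [Finset.sum_const, Finset.card_univ, nsmul_eq_mul, ← Finset.mul_sum]
  simp_rw [e]
  simp only [Finset.sum_const, Finset.card_univ, nsmul_eq_mul, Finset.sum_add_distrib, ← Finset.mul_sum]
  ring

/-- ★★ **COUPLING COSTS (FLUCTUATION) × (SIZE)**: if every mixed second difference of `Φ` is bounded by `C·(α i + α i′)·s` (`α` = the fluctuation
of the first slot's member, `s` = the size of the second slot's members — the shape delivered by ✓`norm_mixedDiff_mlog_le` with `‖A_i − A_{i′}‖ ≤ α i + α i′`,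
`‖a_j − a_{j′}‖ ≤ s`), then `‖n⁻¹·Σ_i Φ i (σ i) − (n²)⁻¹·Σ_{i,j} Φ i j‖ ≤ 2·C·s·(n⁻¹·Σ_i α i)` — chargeable (mean fluctuation) × small (size), for EVERY
bijection `σ`. [cite: Balaban1987RG1, (0.4)–(0.8) p.253] -/
theorem norm_mean_coupled_sub_mean_indep_le [Nonempty ι] (Φ : ι → ι → V) (σ : Equiv.Perm ι) {C s : ℝ} {α : ι → ℝ}
    (hD : ∀ i i' j j', ‖Φ i j - Φ i j' - Φ i' j + Φ i' j'‖ ≤ C * (α i + α i') * s) :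
    ‖((Fintype.card ι : ℝ))⁻¹ • ∑ i, Φ i (σ i) - ((Fintype.card ι : ℝ) ^ 2)⁻¹ • ∑ i, ∑ j, Φ i j‖ ≤
      2 * C * s * (((Fintype.card ι : ℝ))⁻¹ * ∑ i, α i) := by
  have hn : (0 : ℝ) < Fintype.card ι := Nat.cast_pos.mpr Fintype.card_pos
  rw [mean_coupled_sub_mean_indep_eq, norm_smul, norm_inv, norm_pow, Real.norm_of_nonneg hn.le]
  have hle : ∑ i, ∑ j, ∑ i', ‖Φ i (σ i) - Φ i j - Φ i' (σ i) + Φ i' j‖ ≤ ∑ i : ι, ∑ _j : ι, ∑ i' : ι, C * (α i + α i') * s :=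
    Finset.sum_le_sum fun i _ => Finset.sum_le_sum fun j _ => Finset.sum_le_sum fun i' _ => hD i i' (σ i) j
  rw [sum_sum_sum_fluct_eq] at hle
  calc ((Fintype.card ι : ℝ) ^ 3)⁻¹ * ‖∑ i, ∑ j, ∑ i', (Φ i (σ i) - Φ i j - Φ i' (σ i) + Φ i' j)‖
      ≤ ((Fintype.card ι : ℝ) ^ 3)⁻¹ * (2 * C * s * (Fintype.card ι : ℝ) ^ 2 * ∑ i, α i) :=
        mul_le_mul_of_nonneg_left ((norm_sum_sum_sum_le _).trans hle) (by positivity)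
    _ = 2 * C * s * (((Fintype.card ι : ℝ))⁻¹ * ∑ i, α i) := by field_simp

/-- The same with the cruder hypothesis `‖mixed difference‖ ≤ M` uniformly: coupling error `≤ M`. [folklore] -/
theorem norm_mean_coupled_sub_mean_indep_le_of_uniform [Nonempty ι] (Φ : ι → ι → V) (σ : Equiv.Perm ι) {M : ℝ}
    (hD : ∀ i i' j j', ‖Φ i j - Φ i j' - Φ i' j + Φ i' j'‖ ≤ M) :
    ‖((Fintype.card ι : ℝ))⁻¹ • ∑ i, Φ i (σ i) - ((Fintype.card ι : ℝ) ^ 2)⁻¹ • ∑ i, ∑ j, Φ i j‖ ≤ M := by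
  have hn : (0 : ℝ) < Fintype.card ι := Nat.cast_pos.mpr Fintype.card_pos
  rw [mean_coupled_sub_mean_indep_eq, norm_smul, norm_inv, norm_pow, Real.norm_of_nonneg hn.le]
  have hle : ∑ i, ∑ j, ∑ i', ‖Φ i (σ i) - Φ i j - Φ i' (σ i) + Φ i' j‖ ≤ ∑ _i : ι, ∑ _j : ι, ∑ _i' : ι, M :=
    Finset.sum_le_sum fun i _ => Finset.sum_le_sum fun j _ => Finset.sum_le_sum fun i' _ => hD i i' (σ i) j
  simp only [Finset.sum_const, Finset.card_univ, nsmul_eq_mul] at hle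
  calc ((Fintype.card ι : ℝ) ^ 3)⁻¹ * ‖∑ i, ∑ j, ∑ i', (Φ i (σ i) - Φ i j - Φ i' (σ i) + Φ i' j)‖
      ≤ ((Fintype.card ι : ℝ) ^ 3)⁻¹ * ((Fintype.card ι : ℝ) * ((Fintype.card ι : ℝ) * ((Fintype.card ι : ℝ) * M))) :=
        mul_le_mul_of_nonneg_left ((norm_sum_sum_sum_le _).trans hle) (by positivity)
    _ = M := by field_simp

/-! ## §3 Four slots: the chain coupling telescopes into three two-slot couplings -/

/-- ★ **FOUR-SLOT TELESCOPING**: for `Ψ : ι⁴ → V` and bijections `σ₁, σ₂, σ₃` (slot `m+1`'s member continues slot `m`'s), with the intermediate two-slot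
functionals `Φ₁ i j = (n²)⁻¹ Σ_{k,l} Ψ i j k l` (slots 3, 4 still independent), `Φ₂ i j = n⁻¹ Σ_l Ψ (σ₁⁻¹ i) i j l`, `Φ₃ i j = Ψ (σ₁⁻¹ (σ₂⁻¹ i)) (σ₂⁻¹ i) i j`:
`n⁻¹ Σ_i Ψ i (σ₁ i) (σ₂ σ₁ i) (σ₃ σ₂ σ₁ i) − (n⁴)⁻¹ Σ_{i,j,k,l} Ψ i j k l = Σ_{m=1}^{3} (n⁻¹ Σ_i Φ_m i (σ_m i) − (n²)⁻¹ Σ_{i,j} Φ_m i j)` —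
each bracket is a two-slot coupling error (§1–§2). [folklore] -/
theorem mean_chain4_sub_mean_indep_eq [Nonempty ι] (Ψ : ι → ι → ι → ι → V) (σ₁ σ₂ σ₃ : Equiv.Perm ι)
    (Φ₁ Φ₂ Φ₃ : ι → ι → V)
    (h₁ : ∀ i j, Φ₁ i j = ((Fintype.card ι : ℝ) ^ 2)⁻¹ • ∑ k, ∑ l, Ψ i j k l)
    (h₂ : ∀ i j, Φ₂ i j = ((Fintype.card ι : ℝ))⁻¹ • ∑ l, Ψ (σ₁.symm i) i j l)
    (h₃ : ∀ i j, Φ₃ i j = Ψ (σ₁.symm (σ₂.symm i)) (σ₂.symm i) i j) :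
    ((Fintype.card ι : ℝ))⁻¹ • ∑ i, Ψ i (σ₁ i) (σ₂ (σ₁ i)) (σ₃ (σ₂ (σ₁ i))) -
        ((Fintype.card ι : ℝ) ^ 4)⁻¹ • ∑ i, ∑ j, ∑ k, ∑ l, Ψ i j k l =
      (((Fintype.card ι : ℝ))⁻¹ • ∑ i, Φ₃ i (σ₃ i) - ((Fintype.card ι : ℝ) ^ 2)⁻¹ • ∑ i, ∑ j, Φ₃ i j) +
      (((Fintype.card ι : ℝ))⁻¹ • ∑ i, Φ₂ i (σ₂ i) - ((Fintype.card ι : ℝ) ^ 2)⁻¹ • ∑ i, ∑ j, Φ₂ i j) +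
      (((Fintype.card ι : ℝ))⁻¹ • ∑ i, Φ₁ i (σ₁ i) - ((Fintype.card ι : ℝ) ^ 2)⁻¹ • ∑ i, ∑ j, Φ₁ i j) := by
  have hn : (Fintype.card ι : ℝ) ≠ 0 := Nat.cast_ne_zero.mpr Fintype.card_ne_zero
  -- (T1) the independent mean through Φ₁
  have T1 : ((Fintype.card ι : ℝ) ^ 2)⁻¹ • ∑ i, ∑ j, Φ₁ i j = ((Fintype.card ι : ℝ) ^ 4)⁻¹ • ∑ i, ∑ j, ∑ k, ∑ l, Ψ i j k l := by
    simp only [h₁, ← Finset.smul_sum]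
    rw [← mul_smul]; congr 1; field_simp
  -- (T2) coupling slot 2 to slot 1: `n⁻¹ Σ_i Φ₁ i (σ₁ i) = (n²)⁻¹ Σ_{i,j} Φ₂ i j`
  have T2 : ((Fintype.card ι : ℝ))⁻¹ • ∑ i, Φ₁ i (σ₁ i) = ((Fintype.card ι : ℝ) ^ 2)⁻¹ • ∑ i, ∑ j, Φ₂ i j := by
    simp only [h₁, h₂, ← Finset.smul_sum]
    rw [← mul_smul, ← mul_smul]
    have hre : ∑ i, ∑ j, ∑ l, Ψ (σ₁.symm i) i j l = ∑ i, ∑ k, ∑ l, Ψ i (σ₁ i) k l := by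
      rw [← Equiv.sum_comp σ₁ (fun i => ∑ j, ∑ l, Ψ (σ₁.symm i) i j l)]
      simp only [Equiv.symm_apply_apply]
    rw [hre]; congr 1; field_simp
  -- (T3) coupling slot 3 to slot 2
  have T3 : ((Fintype.card ι : ℝ))⁻¹ • ∑ i, Φ₂ i (σ₂ i) = ((Fintype.card ι : ℝ) ^ 2)⁻¹ • ∑ i, ∑ j, Φ₃ i j := by
    simp only [h₂, h₃, ← Finset.smul_sum]
    rw [← mul_smul]
    have hre : ∑ i, ∑ j, Ψ (σ₁.symm (σ₂.symm i)) (σ₂.symm i) i j = ∑ i, ∑ l, Ψ (σ₁.symm i) i (σ₂ i) l := by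
      rw [← Equiv.sum_comp σ₂ (fun i => ∑ j, Ψ (σ₁.symm (σ₂.symm i)) (σ₂.symm i) i j)]
      simp only [Equiv.symm_apply_apply]
    rw [hre]; congr 1; field_simp
  -- (T4) the chain mean through Φ₃
  have T4 : ((Fintype.card ι : ℝ))⁻¹ • ∑ i, Φ₃ i (σ₃ i) =
      ((Fintype.card ι : ℝ))⁻¹ • ∑ i, Ψ i (σ₁ i) (σ₂ (σ₁ i)) (σ₃ (σ₂ (σ₁ i))) := by
    simp only [h₃]
    congr 1
    rw [← Equiv.sum_comp (σ₁.trans σ₂) (fun i => Ψ (σ₁.symm (σ₂.symm i)) (σ₂.symm i) i (σ₃ i))]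
    simp only [Equiv.trans_apply, Equiv.symm_apply_apply]
  rw [← T4, ← T1, T2, T3]
  abel

omit [NormedSpace ℝ V] in
/-- Norm form of §3: the chain-coupling error of a four-slot word is at most the sum of the three two-slot coupling errors. [folklore] -/
theorem norm_sub_le_of_eq_add_add {x a b c : V} (h : x = a + b + c) : ‖x‖ ≤ ‖a‖ + ‖b‖ + ‖c‖ := by
  rw [h]; exact norm_add₃_le

/-- ★ **FOUR-SLOT COUPLING BOUND**: with `Φ₁, Φ₂, Φ₃` as in `mean_chain4_sub_mean_indep_eq` and two-slot coupling errors bounded by `ε₃, ε₂, ε₁`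
(e.g. by §2), `‖chain mean − independent mean‖ ≤ ε₃ + ε₂ + ε₁`. [folklore] -/
theorem norm_mean_chain4_sub_mean_indep_le [Nonempty ι] (Ψ : ι → ι → ι → ι → V) (σ₁ σ₂ σ₃ : Equiv.Perm ι)
    (Φ₁ Φ₂ Φ₃ : ι → ι → V)
    (h₁ : ∀ i j, Φ₁ i j = ((Fintype.card ι : ℝ) ^ 2)⁻¹ • ∑ k, ∑ l, Ψ i j k l)
    (h₂ : ∀ i j, Φ₂ i j = ((Fintype.card ι : ℝ))⁻¹ • ∑ l, Ψ (σ₁.symm i) i j l)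
    (h₃ : ∀ i j, Φ₃ i j = Ψ (σ₁.symm (σ₂.symm i)) (σ₂.symm i) i j) {ε₁ ε₂ ε₃ : ℝ}
    (e₁ : ‖((Fintype.card ι : ℝ))⁻¹ • ∑ i, Φ₁ i (σ₁ i) - ((Fintype.card ι : ℝ) ^ 2)⁻¹ • ∑ i, ∑ j, Φ₁ i j‖ ≤ ε₁)
    (e₂ : ‖((Fintype.card ι : ℝ))⁻¹ • ∑ i, Φ₂ i (σ₂ i) - ((Fintype.card ι : ℝ) ^ 2)⁻¹ • ∑ i, ∑ j, Φ₂ i j‖ ≤ ε₂)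
    (e₃ : ‖((Fintype.card ι : ℝ))⁻¹ • ∑ i, Φ₃ i (σ₃ i) - ((Fintype.card ι : ℝ) ^ 2)⁻¹ • ∑ i, ∑ j, Φ₃ i j‖ ≤ ε₃) :
    ‖((Fintype.card ι : ℝ))⁻¹ • ∑ i, Ψ i (σ₁ i) (σ₂ (σ₁ i)) (σ₃ (σ₂ (σ₁ i))) -
        ((Fintype.card ι : ℝ) ^ 4)⁻¹ • ∑ i, ∑ j, ∑ k, ∑ l, Ψ i j k l‖ ≤ ε₃ + ε₂ + ε₁ := by
  refine (norm_sub_le_of_eq_add_add (mean_chain4_sub_mean_indep_eq Ψ σ₁ σ₂ σ₃ Φ₁ Φ₂ Φ₃ h₁ h₂ h₃)).trans ?_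
  exact add_le_add_three e₃ e₂ e₁

end Summit.QuantumFields.YangMills.Theorems.FluctuationComparisonRegPrIntLS2BetaCouplingIdentity

end
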